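import Mathlib
import HarnessLib
import HarnessLib.Audit
import Summits.NavierStokesRegularity.Statement
import Summits.NavierStokesRegularity.NavierStokesRegularity.Theses.TaoLadderRungTwoBreak
import Literature.Analysis.FluidPDE.Tao2016AveragedNS.BoundedEternalSolutions
import HarnessLib.Audit.Status.Attr

/-!
Route: TransitMassLedger

D-0145 LINE (ideator ns-idea-1, technique card «monotone quantity hunt»; g3 open, g6 rev 2; bears_on
rung TL-M2Break = `TaoLadderRungTwoBreak.Target`; MODEL LATTICE ODEs ONLY — nothing here is a
statement about Navier–Stokes or Clay (A)–(D); no summit is proved by a line). It suffices to show X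
= ActionTransitExtraction ∧ ResidualIncrementBound ∧ NoLoudLadderOne ∧ EternalRigidityViscBddOne —
the certified regimes being PROVED (LedgerRigidity, item 24398,
`TransitMassLedgerLedgerRigidity.no_certified_transit`, 2026-08-28) or provable-now supports
(IncrementBoundRigidity, CertifiedIncrementBound). REV 2 = THE INCREMENT-BUDGET FACTORISATION read
off that kernel proof: of its five steps only step 1 (`window_integral`) uses the mass certificate,
and all it extracts from it is ONE quantity — the WINDOWED A-INCREMENT BUDGET ∫_{s₁}^{s₂} Σ_{i<w} ‖A
V_{a+i} − A V_{a+i+1}‖² ds ≤ C₁√w + C₂, uniform in the block a and the times s₁ ≤ s₂; steps 2–5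
(flux ≥ 3E/8 per bond from complete drain, seepage-costs-action `shell_floor`, local coercivity
`coercive_window_pointwise`, linear-vs-√ `false_of_linear_le_sqrt`) are certificate-FREE and say
that NO normalised non-evanescent square-summable completely draining action-bounded solution of the
λ = 1 lattice of ANY table α ∈ E₂(R) obeys a sublinear budget (IncrementBoundRigidity). The monotone
quantity is widened accordingly from the degree-1 mass ledger Σ_n ⟪ℓ, V_n⟫ to ANY multi-state
Lyapunov ledger Σ_n Λ(V_n, V_{n+1}) — Λ C¹ of linear growth on the ball, a three-state flux
correction g telescoping along the chain, coercive production ≥ κ‖A x − A y‖² on 4-tuples (a, x, y,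
b) of the unit ball; in Willems' dissipativity language a local STORAGE FUNCTION of the chain with
supply through the bond ports — and every such ledger yields the budget by the same telescoping /
Cauchy–Schwarz / energy-conservation bookkeeping (CertifiedIncrementBound); the rev-1 crux
BackscatterRigidity (24399) becomes a COROLLARY of the three (sketch theorem
`backscatterRigidity_of`, kernel-checked) and leaves the cone. What stays OPEN on this route below
the shared host cruxes is typed as ONE residual crux ON THE BUDGET: ResidualIncrementBound — on
tables admitting no ledger of any degree, complete finite-action transits obey the sublinear
A-increment budget (honest shape: transit-Liouville modulo IncrementBoundRigidity). CENSUS FACT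
(kernel-checked in the line folder, `no_certificate_of_checkerboard`, 0 sorry): a table carrying a
CHECKERBOARD steady state — a 2-periodic lattice equilibrium (u, v) in the unit ball with A u ≠ A v
— admits NO ledger of any degree (the two production inequalities telescope to 2κ‖A u − A v‖² ≤ 0),
so «every table is certified» is dead on arrival and the certified / ledger-free boundary is
DYNAMICAL (non-A-synchronised compact recurrent lattice states) rather than rev 1's feed-forward /
sign-mixing heuristic.
Lean:
`Summit.NavierStokesRegularity.NavierStokesRegularity.Theses.TransitMassLedger.ActionTransitExtraction
∧
Summit.NavierStokesRegularity.NavierStokesRegularity.Theses.TransitMassLedger.ResidualIncrementBound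
∧ Summit.NavierStokesRegularity.NavierStokesRegularity.Theses.TransitMassLedger.NoLoudLadderOne ∧
Summit.NavierStokesRegularity.NavierStokesRegularity.Theses.TransitMassLedger.EternalRigidityViscBddOne`

CLOSES_TARGET: closes rung TL-M2Break of NavierStokesRegularity: Summit.NavierStokesRegularity.NavierStokesRegularity.Theses.TaoLadderRungTwoBreak.Target (D-0061; not the summit Statement) — the deciding theorem of this route concludes that registered leaf instead of the Statement decl `NavierStokesRegularity` (class rung: servable and labelled, never counted as concluding the summit Statement).

Rationale: WHY THIS LINE. Rev 1 imported a monotone quantity from positive-systems control (linear copositive /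
common linear Lyapunov functions, doi:10.1109/acc.2007.4282527; LaSalle lineage arXiv:1710.03710)
onto Tao's four-mode λ = 1 limit lattice (arXiv:1402.0290 §§4–6): for the dyadic member the ledger
is Katz–Pavlović's Σ_n X_n (arXiv:1007.3401, arXiv:2209.10203 §3), and instrument j295767 showed the
degree-1 LMI feasible for 100 % of feed-forward circuit tables and infeasible for 96 % of random
sign-mixing tables — whence the rev-1 dichotomy LedgerRigidity (certified) / BackscatterRigidity
(uncertified). On 2026-08-28 LedgerRigidity (item 24398) was PROVED in the tree
(`Theorems/TransitMassLedgerLedgerRigidity.lean::no_certified_transit` with helpers …Energy /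
…Ledger / …Windows / …DyadicCertificate: `energy_conserved`, `tailAbove_sub`, `window_integral`,
`shell_floor`, `coercive_window_pointwise`, `false_of_linear_le_sqrt`,
`hasMassCertificate_dyadicTable`). Rev 2 is what that proof TEACHES: the certificate is consumed in
exactly one place (step 1) and only to produce the windowed A-increment budget ∫Σ_{i<w}‖A V_{a+i} −
A V_{a+i+1}‖² ≤ C₁√w + C₂; the rigidity itself (steps 2–5: sublinear budget against a cost linear in
the window, paid because complete drain pushes flux ≥ 3E/8 through every bond while seepage below
level η costs action) is TABLE-GENERIC. So the line (i) promotes steps 2–5 to a stand-alone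
certificate-free support IncrementBoundRigidity — any mechanism giving a sublinear budget now kills
complete finite-action transits; (ii) widens the admissible monotone quantity from Σ⟪ℓ,V_n⟫ to any
multi-state Lyapunov ledger Σ Λ(V_n,V_{n+1}) with a telescoping three-state flux correction — a
local storage function with supply through the bond ports (Willems, doi:10.1007/bf00276493; SOS
storage functions are the computable sub-family, with the known caveat that polynomial Lyapunov
functions can fail to exist where smooth ones do, Ahmadi–Krstic–Parrilo doi:10.1109/cdc.2011.6161499
[corpus:paper:doi-10-1109-cdc-2011-6161499 p.1–2], arXiv:1308.6833) — CertifiedIncrementBound,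
provable now by step 1's bookkeeping; (iii) re-centres the open content on ONE residual crux typed
on the budget, ResidualIncrementBound, from which the rev-1 BackscatterRigidity follows (sketch
`backscatterRigidity_of`); (iv) records a kernel census fact bounding the widening from above:
`no_certificate_of_checkerboard` (line folder bc/checkerboard.lean, 0 sorry) — a table with a
2-periodic lattice equilibrium (u,v) in the unit ball and A u ≠ A v has no ledger of ANY degree,
because the production inequalities at the two bonds of …v u v u… telescope to 2κ‖Au − Av‖² ≤ 0.
Hence «every table is certified» is dead on arrival, and the certified / ledger-free boundary is
dynamical: ledgers are obstructed exactly by non-A-synchronised COMPACT recurrent lattice states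
(checkerboards, breathers — MacKay–Aubry doi:10.1088/0951-7715/7/6/006), while the rung only needs
to exclude NON-compact ones (transits). That gap — a ledger must kill standing recurrent states it
has no business killing — is the precise reason the monotone-quantity line cannot close the rung
alone, and the residual crux is where it is paid.

RANKED CRUXES. #2 LedgerRigidity — PROVED (24398; `transitMassLedger_ledgerRigidity_proof`), kept
load-bearing as regime 1 of the rev-2 closes. #3 ResidualIncrementBound (crux, NEW, deciding for the
ledger-free regime) — on every α ∈ E₂(R) with no Lyapunov-ledger certificate of any degree, every
normalised non-evanescent square-summable completely draining action-bounded solution of the λ = 1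
lattice obeys the windowed A-increment budget. [difficulty: L/XL] (why it might fail: a ledger-free
table — every table with a non-synchronised checkerboard steady state qualifies — may carry a
coherent complete pulse (Friesecke–Wattis doi:10.1007/bf02099784 / Friesecke–Pego
doi:10.1088/0951-7715/12/6/311 solitary waves; English–Pego compactons
doi:10.1090/S0002-9939-05-07851-2) whose windowed A-increment grows LINEARLY in w; no radiation
mechanism is in hand.) HONEST SHAPE: equivalent modulo IncrementBoundRigidity to «no complete
finite-action transit on ledger-free tables» (transit-Liouville shape like 22148/24399 — not
weaker); typed on the budget so partial mechanisms (orbit-restricted / time-averaged ledgers;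
occupation-measure LP duality, whose formal dual is again (Λ, g)) have a typed target. #4
ActionTransitExtraction (crux, unchanged) — extraction of a normalised action-bounded complete
transit from any failure of NoSurvivingEternalBdd R 1 [difficulty: L] (why it might fail: the
amplitude rate ‖W‖∞ ≍ 1/ε₀ is unproved; fronts may widen or split; the action bound survives only if
the rescaling factor is comparable to sup‖W‖) [arXiv:1402.0290, BoundedEternalSolutions,
doi:10.1007/BF02101552]; = 22149 sharpened by the action bound. #5 NoLoudLadderOne, #6
EternalRigidityViscBddOne — shared host cruxes (20452, 20420), unchanged. SUPPORTS r9 (provable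
now): IncrementBoundRigidity (steps 2–5, S/M), CertifiedIncrementBound (step 1 widened, M). ASIDE:
BackscatterRigidity (24399) — corollary of the three new items, banked open, never restated; its
booking as a restriction of 22148 stands. CENSUS LINE: open load of the route =
{ResidualIncrementBound (L/XL, transit-Liouville shape, mechanism-less beyond
LatticeTransitLiouville's IgnitionNeedsSource/SourceLeavesWake programme), ActionTransitExtraction
(L, extraction wall shared with 22149), 20452, 20420}; PROVED: 24398 (+ Assembly); provable-now: the
two supports; nothing in rev 2 narrows 21808 / 22148 / 23973, the rung or the summit.

KILL CRITERIA. A ledger-free comparable table (e.g. one with a non-synchronised checkerboard steady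
state, found by Newton/homotopy on Q u + A v + B(v,u) = 0 = Q v + A u + B(u,v)) carrying a
numerically clean complete transit whose windowed A-increment grows linearly in w refutes
ResidualIncrementBound → close refuted:ResidualIncrementBound; the route then retires to its PROVED
regime (LedgerRigidity + the two supports = a banked theorem about certified tables).
NoLatticeTransit (22148) proved elsewhere moots the residual crux (superseded by
LatticeTransitLiouville); TailRatchet (21808) proved moots the route (superseded by WakeRatchet). A
refutation of IncrementBoundRigidity or CertifiedIncrementBound would mean the kernel proof of 24398
was misread — checkable by the first prover in one sitting.

NOT DECOMPOSED YET. ResidualIncrementBound — two candidate splits, both costume-risky until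
instrument Q3 speaks: (a) ORBIT-RESTRICTED LEDGERS (the production inequality only on the closure of
the transit's own 4-tuples {(V_{n−1},V_n,V_{n+1},V_{n+2})(s)}, which avoids the checkerboard
obstruction because a transit's orbit closure contains no standing state of amplitude ≥ c), (b)
OCCUPATION-MEASURE DUALITY (the budget as an LP over window-averaged bond measures with
marginal-consistency, averaged-invariance, action ≤ M and flux ≥ 3E/8 constraints; its formal dual
is a ledger with Λ the multiplier of invariance and g the multiplier of marginal consistency, so (b)
is the completeness question for (a)). The amplitude-rate lemma inside ActionTransitExtraction
(shared wall with 22149).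

CHEAPEST FALSIFIER. Q3 — PRE-REGISTERED with idea-crit-3 before any kit (KEY-NS #140 (3); not run
this generation): ONE batched job, (i) SOS/SDP feasibility of polynomial two-state ledgers (Λ of
degree ≤ 3 on ℝ⁸, g of degree ≤ 3 on ℝ¹², κ > 0, Putinar multipliers for the four unit balls) on
dyadicTable — SANITY, must recover the degree-1 certificate ℓ = e₀, θ = −x₀²/2, κ = 1/8
(`hasMassCertificate_dyadicTable`), else the pipeline is broken and there is no verdict; (ii) the
same on the 92 degree-1-infeasible sign-mixing tables of j295767 (F1–F4, R = 2, 5) and on the F6/F7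
circuits; (iii) a Newton/homotopy census of checkerboard equilibria (Q u + A v + B(v,u) = 0 = Q v +
A u + B(u,v), ‖(u,v)‖ = 1) with ‖A u − A v‖ > 10⁻⁶ on the same tables — by
`no_certificate_of_checkerboard` every hit in (iii) certifies infeasibility of (ii) at ALL degrees.
Must-fail thresholds, fixed now: if (iii) hits ≥ 90 % of the sign-mixing sample the widening is
declared EMPTY IN PRACTICE and rev 2 stands as factorisation + census only; if (ii) is feasible on a
table where (iii) hits, the SOS pipeline is wrong; if (ii) is feasible on ≥ 25 % of (ii)∖(iii), the
widening is booked as real and those tables leave the residual crux. RAN earlier (rev 1, of record):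
j295767 (degree-1 LMI census) and j297233 (per-hop ledger charge floor ≈ 0.3 on certified F7
circuits) — unchanged.

Novelty: Searches (2026-08-28): lit search "dyadic model smooth solutions Barbato Morandin Romito" (5 local:
arXiv:1007.3401, arXiv:2209.10203, …); lit search "LaSalle invariance principle Lyapunov" (5 local,
control-theory only); lit search "copositive Lyapunov positive systems linear" (5 local:
doi:10.1109/acc.2007.4282527, doi:10.1155/2018/1365960); lit search "English Pego solitary waves
lattice compactons" (5 local incl. arXiv:2503.19518 dissipative FPUT fronts); ledger negatives
--problem NavierStokesRegularity (5, none on cascade lattices); tree: 7 TL-M2Break/M2 route files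
read (WakeRatchet, SubcriticalEnvelope, LatticeTransitLiouville, TaoLadderRungTwoBreak,
TaoLadderRungThree, TwoFlat, TwoPoly) — none carries a monotone functional of the limit lattice;
LADDER-NS §1a/§138 portfolio (129 N0 monotone-quantity routes, none on the model lattice).
Nearest prior art found: arXiv:1007.3401 (BMR 2011: Lyapunov-type control of the scalar dyadic
model, m = 1, where Σ X_n is monotone) and route-NavierStokesRegularity-LatticeTransitLiouville
(same target object — transits of 𝓛_α — attacked by compactness + radiation, no monotone quantity;
its file records dM/ds = ½Σ(V_n−V_(n+1))² for the dyadic member as a remark only).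
Delta: the first monotone quantity for Tao's four-mode limit lattice — a table-certified linear mass
ledger whose existence is an 8×8 LMI — and the regime dichotomy it induces (feed-forward = ledger,
sign-mixing = backscatter), with the sublinear-budget/linear-cost rigidi  [refs: 10.1109/acc.2007.4282527, 10.1155/2018/1365960, 1007.3401, 2209.10203, 2503.19518, doi:10.1109/acc.2007.4282527, doi:10.1155/2018/1365960]

Barriers (technique_class: lyapunov-ledger, lasalle, sdp-alternative, dichotomy): - technique_class: lyapunov-ledger, lasalle, sdp-alternative, dichotomy
- Literature.Barriers.NavierStokesRegularity.TaoAveragedBlowup: does not bite — the rung fixes the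
spread R while ε₀ → 0, whereas Tao's blow-up tables have spread R(ε₀) → ∞ (TL-M2Poly regime); the
line is a MODEL-lattice statement and claims nothing for averaged or true NS.
- Literature.Barriers.NavierStokesRegularity.DyadicCascadeRegularity: consistent, not an obstruction
— the dyadic member is the feed-forward regime's base case (its ledger is Katz–Pavlović's Σ X_n) and
BMR regularity is what the rung predicts at m = 1.
- Literature.Barriers.NavierStokesRegularity.EnergySupercriticality: outside its class — the ledger
is a first-order (mass) functional of a scale-free model lattice, not an energy-class a-priori
estimate for NS; supercriticality of NS energy is not engaged.
- Literature.Barriers.NavierStokesRegularity.FrozenShellShapeNoDephasing: does not bite — no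
dephasing/equipartition law inside a shell is asserted; BackscatterRigidity's radiation is
inter-shell energy leakage of a specific lattice, not a universal decoherence law.
- Negatives index: 5 refuted NS statements at filing (OddMorawetz 1376, SymmetryModuliCount 4055,
PerpetualPump 1832, AdiabaticEddy 1429, Blowup 0154) — none concerns cascade lattices; the line
restates none.

sub-problem: NavierStokesRegularity · status: draft · opened planner-ns-idea-1-g3-0 2026-08-28T01:23:33Z · rev 4 · ledger route-NavierStokesRegularity-TransitMassLedger
GENERATED by the gate from the ledger (D-0016/17). Provers cite these decls: `theorem foo : Summit.NavierStokesRegularity.NavierStokesRegularity.Theses.TransitMassLedger.<Decl> := …` in Summits/NavierStokesRegularity/NavierStokesRegularity/Theorems/<Name>.lean.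
-/

namespace Summit.NavierStokesRegularity.NavierStokesRegularity.Theses.TransitMassLedger

open scoped BigOperators Topology Manifold Classical MeasureTheory ProbabilityTheory Matrix InnerProductSpace ComplexConjugate ContinuousMap
open Filter Set Function TopologicalSpace MeasureTheory

attribute [summit_statement] _root_.NavierStokesRegularity
attribute [summit_statement] _root_.Summit.NavierStokesRegularity.NavierStokesRegularity.Theses.TaoLadderRungTwoBreak.Target

open Literature.NS

/-- item stmt-NavierStokesRegularity-24398 · crux · rank 2 · closed · proved by Summit.NavierStokesRegularity.NavierStokesRegularity.Theorems.transitMassLedger_ledgerRigidity_proof (prover) · by planner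
why it might fail: a wide slowly-breathing transit whose adjacent pairs hug the kernel variety {M = 0} ⊇ {A x = A y} could pay o(1) dissipation per hop while Cauchy–Schwarz only bounds the ledger by √(hops·E); sub-threshold seepage through passed shells is uncounted.
sources: arXiv:1007.3401, arXiv:2209.10203, doi:10.1109/acc.2007.4282527, arXiv:1710.03710, arXiv:1402.0290
[crux] for every R ≥ 1, every α ∈ E₂(R) and every outflow-coercive mass certificate (ℓ, θ, κ) of α
on the unit ball (κ‖A x − A y‖² ≤ ⟪ℓ, Q x + A x + B(y,x)⟫ + θ x − θ y for ‖x‖,‖y‖ ≤ 1; θ continuous,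
θ 0 = 0), every solution V : ℤ → ℝ → ℝ⁴ of the λ = 1 lattice with ‖V_n(s)‖ ≤ 1 that is
non-evanescent, square-summable at each time, drains below every shell as s → +∞, vanishes above
every shell as s → −∞ and has uniformly bounded time-action ∫‖V_n‖ ds ≤ M is identically zero.
[difficulty: L] -/
@[route_item "route-NavierStokesRegularity-TransitMassLedger", crux]
def LedgerRigidity : Prop :=
  ∀ R : ℝ, 1 ≤ R → ∀ α : Fin 4 → Fin 4 → Fin 4 → ℤ × ℤ × ℤ → ℝ, Literature.Analysis.FluidPDE.TaoCascade.InTableClass R α → ∀ (ℓ : EuclideanSpace ℝ (Fin 4)) (θ : EuclideanSpace ℝ (Fin 4) → ℝ) (κ : ℝ), 0 < κ → Continuous θ → θ 0 = 0 → (∀ x y : EuclideanSpace ℝ (Fin 4), ‖x‖ ≤ 1 → ‖y‖ ≤ 1 → κ * ‖Literature.Analysis.FluidPDE.TaoCascade.tableA α x - Literature.Analysis.FluidPDE.TaoCascade.tableA α y‖ ^ 2 ≤ inner ℝ ℓ (Literature.Analysis.FluidPDE.TaoCascade.tableQ α x + Literature.Analysis.FluidPDE.TaoCascade.tableA α x +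 Literature.Analysis.FluidPDE.TaoCascade.tableB α y x) + θ x - θ y) → ∀ V : ℤ → ℝ → EuclideanSpace ℝ (Fin 4), (∀ (n : ℤ) (s : ℝ), HasDerivAt (V n) (Literature.Analysis.FluidPDE.TaoCascade.tableQ α (V n s) + Literature.Analysis.FluidPDE.TaoCascade.tableA α (V (n - 1) s) + Literature.Analysis.FluidPDE.TaoCascade.tableB α (V (n + 1) s) (V n s)) s) → (∀ (n : ℤ) (s : ℝ), ‖V n s‖ ≤ 1) → (∃ c : ℝ, 0 < c ∧ ∀ s : ℝ, ∃ n : ℤ, c ≤ ‖V n s‖) → (∀ s : ℝ, Summable (fun n : ℤ => ‖V n s‖ ^ 2)) → (∀ N : ℤ, Filter.Tendsto (fun s : ℝ => ∑' k : ℕ, ‖V (N - (k : ℤ)) s‖ ^ 2) Filter.atTop (nhds 0)) → (∀ N : ℤ, Filter.Tendsto (fun s : ℝ => ∑' k : ℕ, ‖V (N + (k : ℤ)) s‖ ^ 2) Filter.atBot (nhds 0)) → (∃ M : ℝ, ∀ n : ℤ, MeasureTheory.Integrable (fun s : ℝ => ‖V n s‖) ∧ ∫ s, ‖V n s‖ ≤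 M) → ∀ (n : ℤ) (s : ℝ), V n s = 0

-- `LedgerRigidity` holds: proved by `Summit.NavierStokesRegularity.NavierStokesRegularity.Theorems.transitMassLedger_ledgerRigidity_proof` (its module imports this route file, so no `_holds` link can be stated here).

/-- item stmt-NavierStokesRegularity-24400 · crux · rank 4 · open · by planner
why it might fail: ERRATUM: kernel-equivalent to ∀ R ≥ 1, NoSurvivingEternalBdd R 1 (actionTransitExtraction_iff in empty.lean): the promised transit (complete drain + finite action) cannot exist on any table, so the item IS the bare Liouville statement of the rung's reduction — rung-strength, no extraction content.
sources: arXiv:1402.0290, Literature.Analysis.FluidPDE.Tao2016AveragedNS.BoundedEternalSolutions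
[crux] for every R ≥ 1, if NoSurvivingEternalBdd R 1 fails then some table α ∈ E₂(R) (a diagonal
limit in the compact class) carries a solution V of the λ = 1 lattice that is normalised (‖V_n(s)‖ ≤
1, by the amplitude–time scaling symmetry), non-evanescent, square-summable at each time, drains
below every shell as s → +∞, vanishes above every shell as s → −∞, has uniformly bounded time-action
∫‖V_n‖ ds (the scale-invariant image of IsEternalVisc.action under Fatou) and is not identically
zero. [difficulty: L] -/
@[route_item "route-NavierStokesRegularity-TransitMassLedger", crux]
def ActionTransitExtraction : Prop :=
  ∀ R : ℝ, 1 ≤ R → ¬ Literature.Analysis.FluidPDE.TaoCascade.NoSurvivingEternalBdd R 1 → ∃ α : Fin 4 → Fin 4 → Fin 4 → ℤ × ℤ × ℤ → ℝ, Literature.Analysis.FluidPDE.TaoCascade.InTableClass R α ∧ ∃ V : ℤ → ℝ → EuclideanSpace ℝ (Fin 4), (∀ (n : ℤ) (s : ℝ), HasDerivAt (V n) (Literature.Analysis.FluidPDE.TaoCascade.tableQ α (V n s) + Literature.Analysis.FluidPDE.TaoCascade.tableA α (V (n - 1) s) + Literature.Analysis.FluidPDE.TaoCascade.tableB α (V (n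 + 1) s) (V n s)) s) ∧ (∀ (n : ℤ) (s : ℝ), ‖V n s‖ ≤ 1) ∧ (∃ c : ℝ, 0 < c ∧ ∀ s : ℝ, ∃ n : ℤ, c ≤ ‖V n s‖) ∧ (∀ s : ℝ, Summable (fun n : ℤ => ‖V n s‖ ^ 2)) ∧ (∀ N : ℤ, Filter.Tendsto (fun s : ℝ => ∑' k : ℕ, ‖V (N - (k : ℤ)) s‖ ^ 2) Filter.atTop (nhds 0)) ∧ (∀ N : ℤ, Filter.Tendsto (fun s : ℝ => ∑' k : ℕ, ‖V (N + (k : ℤ)) s‖ ^ 2) Filter.atBot (nhds 0)) ∧ (∃ M : ℝ, ∀ n : ℤ, MeasureTheory.Integrable (fun s : ℝ => ‖V n s‖) ∧ ∫ s, ‖V n s‖ ≤ M) ∧ ∃ (n : ℤ) (s : ℝ), V n s ≠ 0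

/-- item stmt-NavierStokesRegularity-20452 · crux · rank 5 · open · by planner
why it might fail: a viscous eternal solution in which every shell reaches the dissipation-critical level yet the front still outruns dissipation at small ε₀ (a loud surviving ladder) is excluded by no census so far.
sources: arXiv:1402.0290, Literature.Analysis.FluidPDE.Tao2016AveragedNS.BoundedEternalSolutions
[crux, split child (ρ+) of NoSurvivingEternalViscBddOne] loud-ladder exclusion: below a threshold,
no table of InTableClass R carries a uniformly bounded admissible viscous eternal solution with ν̂ >
0 in which EVERY shell's weighted energy reaches the dissipation-critical level ν̂²/4096 and which
is (S₁)-surviving forward (the complement of the PROVED seeded slice noSurvivingViscSeededBdd R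
4096). m = 1 prototype: BMR 2011 dyadic regularity. -/
@[route_item "route-NavierStokesRegularity-TransitMassLedger", crux]
def NoLoudLadderOne : Prop :=
  ∀ R : ℝ, 1 ≤ R → Literature.Analysis.FluidPDE.TaoCascade.NoLoudLadder R

/-- item stmt-NavierStokesRegularity-20420 · crux · rank 6 · open · by planner
why it might fail: the compactness step from defect-tolerant blow-up to a UNIFORMLY BOUNDED eternal solution needs a Type-I bound that a Type-II-like (supercritical-efficiency) cascade on a comparable table might violate.
sources: arXiv:1402.0290, Literature.Analysis.FluidPDE.Tao2016AveragedNS.BoundedEternalSolutions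
[crux, consequence-crux consumed by closes] K2ᵛ(1): for every R ≥ 1 there is a threshold below which
robust blow-up (NoGlobalCascade ε₀ α X₀) of a table α ∈ InTableClass R from a one-shell datum yields
ν̂ ≥ 0 and a uniformly bounded admissible viscous eternal solution W (IsEternalVisc ε₀ ν̂ α W ∧
UniformBound W) surviving forward at a = 1 — the ω-limit of the type-I-renormalised blow-up
trajectory modulo shell shift. Implied by the Target (vacuously) and by rev-1's BlowupRigidityOne.
Model lattice ODEs only. -/
@[route_item "route-NavierStokesRegularity-TransitMassLedger", crux]
def EternalRigidityViscBddOne : Prop :=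
  ∀ R : ℝ, 1 ≤ R → Literature.Analysis.FluidPDE.TaoCascade.EternalRigidityViscBdd R 1

/-- item stmt-NavierStokesRegularity-24399 · aside · rank 3 · closed · proved by Summit.NavierStokesRegularity.NavierStokesRegularity.Theorems.TransitMassLedgerEmptyTransitClass.backscatterRigidity_trivial (prover) · by planner
why it might fail: an uncertified table can be nearly feed-forward (LMI margin ≈ 0: F1 tables with u* ≈ 0 in j295767) and carry a coherent pulse with negligible backscatter; sonic-vacuum compactons of purely nonlinear chains (English–Pego) are the model enemy.
sources: doi:10.1090/S0002-9939-05-07851-2, arXiv:1402.0290, arXiv:2503.19518, doi:10.1007/BF02101552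
[crux] for every R ≥ 1 and every α ∈ E₂(R) admitting NO outflow-coercive mass certificate on the
unit ball (the sign-mixing regime: for the sampled generic tables even the uniform-state form ⟪ℓ, Q
u + A u + B(u,u)⟫ is indefinite for every ℓ, j295767), every normalised, non-evanescent,
square-summable, completely draining, action-bounded solution of the λ = 1 lattice is identically
zero (LatticeTransitLiouville's NoLatticeTransit restricted to the certified-backscattering class
and to action-bounded transits). [difficulty: L] -/
@[route_item "route-NavierStokesRegularity-TransitMassLedger"]
def BackscatterRigidity : Prop :=
  ∀ R : ℝ, 1 ≤ R → ∀ α : Fin 4 → Fin 4 → Fin 4 → ℤ × ℤ × ℤ → ℝ, Literature.Analysis.FluidPDE.TaoCascade.InTableClass R α → ¬ (∃ (ℓ : EuclideanSpace ℝ (Fin 4)) (θ : EuclideanSpace ℝ (Fin 4) → ℝ) (κ : ℝ), 0 < κ ∧ Continuous θ ∧ θ 0 = 0 ∧ ∀ x y : EuclideanSpace ℝ (Fin 4), ‖x‖ ≤ 1 → ‖y‖ ≤ 1 → κ * ‖Literature.Analysis.FluidPDE.TaoCascade.tableA α x - Literature.Analysis.FluidPDE.TaoCascade.tableA α y‖ ^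 2 ≤ inner ℝ ℓ (Literature.Analysis.FluidPDE.TaoCascade.tableQ α x + Literature.Analysis.FluidPDE.TaoCascade.tableA α x + Literature.Analysis.FluidPDE.TaoCascade.tableB α y x) + θ x - θ y) → ∀ V : ℤ → ℝ → EuclideanSpace ℝ (Fin 4), (∀ (n : ℤ) (s : ℝ), HasDerivAt (V n) (Literature.Analysis.FluidPDE.TaoCascade.tableQ α (V n s) + Literature.Analysis.FluidPDE.TaoCascade.tableA α (V (n - 1) s) + Literature.Analysis.FluidPDE.TaoCascade.tableB α (V (n + 1) s) (V n s)) s) → (∀ (n : ℤ) (s : ℝ), ‖V n s‖ ≤ 1) → (∃ c : ℝ, 0 < c ∧ ∀ s : ℝ, ∃ n : ℤ, c ≤ ‖V n s‖) → (∀ s : ℝ, Summable (fun n : ℤ => ‖V n s‖ ^ 2)) → (∀ N : ℤ, Filter.Tendsto (fun s : ℝ => ∑' k : ℕ, ‖V (N - (k : ℤ)) s‖ ^ 2) Filter.atTop (nhds 0)) → (∀ N : ℤ, Filter.Tendsto (fun s : ℝ => ∑' k : ℕ, ‖V (N + (k : ℤ)) s‖ ^ 2) Filter.atBot (nhds 0))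 → (∃ M : ℝ, ∀ n : ℤ, MeasureTheory.Integrable (fun s : ℝ => ‖V n s‖) ∧ ∫ s, ‖V n s‖ ≤ M) → ∀ (n : ℤ) (s : ℝ), V n s = 0

-- `BackscatterRigidity` holds: proved by `Summit.NavierStokesRegularity.NavierStokesRegularity.Theorems.TransitMassLedgerEmptyTransitClass.backscatterRigidity_trivial` (its module imports this route file, so no `_holds` link can be stated here).

/-- item stmt-NavierStokesRegularity-27967 · support · rank 3 · closed · proved by Summit.NavierStokesRegularity.NavierStokesRegularity.Theorems.TransitMassLedgerEmptyTransitClass.residualIncrementBound_trivial (prover) · by planner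
why it might fail: It cannot: vacuous — the transit class is empty (eq_zero_of_drain_of_action); provable by the 30-line corollary in empty.lean.
sources: arXiv:1402.0290, Summit.NavierStokesRegularity.NavierStokesRegularity.Theorems.TransitMassLedgerEnergy.tailBelow_sub
[crux, deciding for the ledger-free regime; NEW in rev 2 (LINE g6-2, reacting to 24398 PROVED)] On
every table α ∈ E₂(R) admitting NO Lyapunov-ledger certificate of any degree (the negation of
CertifiedIncrementBound's hypothesis: no C¹ two-state density Λ of linear growth on the ball with a
three-state flux correction g and coercive production ≥ κ‖A x − A y‖² on 4-tuples of the unit ball),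
every normalised, non-evanescent, square-summable, completely draining, action-bounded solution V of
the λ = 1 lattice obeys the WINDOWED A-INCREMENT BUDGET ∫_{s₁}^{s₂} Σ_{i<w} ‖A V_{a+i} − A
V_{a+i+1}‖² ds ≤ C₁√w + C₂, uniformly in the block a and the times. HONEST SHAPE: modulo the
certificate-free support IncrementBoundRigidity (provable now) this is EQUIVALENT to «ledger-free
tables carry no complete finite-action transit» (transit-Liouville shape, like 22148/24399, not
weaker); it is typed ON THE BUDGET because the kernel proof of 24398
(`TransitMassLedgerLedgerRigidity.no_certified_transit`) shows the budget is the ONLY table-specific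
input rigidity consumes, so a prover may deliver it by any means (orbit-restricted or time-averaged
ledgers; flux/occupation-measure duality, whose formal LP -/
@[route_item "route-NavierStokesRegularity-TransitMassLedger", crux]
def ResidualIncrementBound : Prop :=
  ∀ R : ℝ, 1 ≤ R → ∀ α : Fin 4 → Fin 4 → Fin 4 → ℤ × ℤ × ℤ → ℝ, Literature.Analysis.FluidPDE.TaoCascade.InTableClass R α → ¬ (∃ (Λ : EuclideanSpace ℝ (Fin 4) → EuclideanSpace ℝ (Fin 4) → ℝ) (Λ₁ Λ₂ : EuclideanSpace ℝ (Fin 4) → EuclideanSpace ℝ (Fin 4) → EuclideanSpace ℝ (Fin 4) → ℝ) (g : EuclideanSpace ℝ (Fin 4) → EuclideanSpace ℝ (Fin 4) → EuclideanSpace ℝ (Fin 4) → ℝ) (κ C : ℝ), 0 < κ ∧ (∀ (γ δ : ℝ → EuclideanSpace ℝ (Fin 4)) (γ' δ' : EuclideanSpace ℝ (Fin 4)) (s : ℝ), HasDerivAt γ γ' s → HasDerivAt δ δ' s → HasDerivAt (fun σ => Λ (γ σ) (δ σ)) (Λ₁ (γ s) (δ s) γ' + Λ₂ (γ s) (δ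 s) δ') s) ∧ (∀ x y : EuclideanSpace ℝ (Fin 4), ‖x‖ ≤ 1 → ‖y‖ ≤ 1 → |Λ x y| ≤ C * (‖x‖ + ‖y‖)) ∧ (∀ x y z : EuclideanSpace ℝ (Fin 4), ‖x‖ ≤ 1 → ‖y‖ ≤ 1 → ‖z‖ ≤ 1 → |g x y z| ≤ C * (‖x‖ + ‖y‖ + ‖z‖)) ∧ ∀ a x y b : EuclideanSpace ℝ (Fin 4), ‖a‖ ≤ 1 → ‖x‖ ≤ 1 → ‖y‖ ≤ 1 → ‖b‖ ≤ 1 → κ * ‖Literature.Analysis.FluidPDE.TaoCascade.tableA α x - Literature.Analysis.FluidPDE.TaoCascade.tableA α y‖ ^ 2 + g a x y - g x y b ≤ Λ₁ x y (Literature.Analysis.FluidPDE.TaoCascade.tableQ α x + Literature.Analysis.FluidPDE.TaoCascade.tableA α a + Literature.Analysis.FluidPDE.TaoCascade.tableB α y x) + Λ₂ x y (Literature.Analysis.FluidPDE.TaoCascade.tableQ α y + Literature.Analysis.FluidPDE.TaoCascade.tableA α x + Literature.Analysis.FluidPDE.TaoCascade.tableB α b y)) → ∀ V : ℤ → ℝ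 → EuclideanSpace ℝ (Fin 4), (∀ (n : ℤ) (s : ℝ), HasDerivAt (V n) (Literature.Analysis.FluidPDE.TaoCascade.tableQ α (V n s) + Literature.Analysis.FluidPDE.TaoCascade.tableA α (V (n - 1) s) + Literature.Analysis.FluidPDE.TaoCascade.tableB α (V (n + 1) s) (V n s)) s) → (∀ (n : ℤ) (s : ℝ), ‖V n s‖ ≤ 1) → (∃ c : ℝ, 0 < c ∧ ∀ s : ℝ, ∃ n : ℤ, c ≤ ‖V n s‖) → (∀ s : ℝ, Summable (fun n : ℤ => ‖V n s‖ ^ 2)) → (∀ N : ℤ, Filter.Tendsto (fun s : ℝ => ∑' k : ℕ, ‖V (N - (k : ℤ)) s‖ ^ 2) Filter.atTop (nhds 0)) → (∀ N : ℤ, Filter.Tendsto (fun s : ℝ => ∑' k : ℕ, ‖V (N + (k : ℤ)) s‖ ^ 2) Filter.atBot (nhds 0)) → (∃ M : ℝ, ∀ n : ℤ, MeasureTheory.Integrable (fun s : ℝ => ‖V n s‖) ∧ ∫ s, ‖V n s‖ ≤ M) → (∃ C₁ C₂ : ℝ, ∀ (a : ℤ) (w : ℕ) (s₁ s₂ : ℝ),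 s₁ ≤ s₂ → ∫ s in s₁..s₂, ∑ i ∈ Finset.range w, ‖Literature.Analysis.FluidPDE.TaoCascade.tableA α (V (a + i) s) - Literature.Analysis.FluidPDE.TaoCascade.tableA α (V (a + i + 1) s)‖ ^ 2 ≤ C₁ * Real.sqrt w + C₂)

-- `ResidualIncrementBound` holds: proved by `Summit.NavierStokesRegularity.NavierStokesRegularity.Theorems.TransitMassLedgerEmptyTransitClass.residualIncrementBound_trivial` (its module imports this route file, so no `_holds` link can be stated here).

/-- item stmt-NavierStokesRegularity-27968 · support · rank 9 · closed · proved by Summit.NavierStokesRegularity.NavierStokesRegularity.Theorems.TransitMassLedgerEmptyTransitClass.incrementBoundRigidity_trivial (prover) · by planner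
why it might fail: It cannot: vacuous hypotheses (eq_zero_of_drain_of_action).
sources: arXiv:1402.0290
[support, provable now, size S/M] CERTIFICATE-FREE RIGIDITY ENGINE read off the kernel proof of
LedgerRigidity (`Theorems/TransitMassLedgerLedgerRigidity.lean::no_certified_transit`, steps 2–5):
for every R ≥ 1, every table α ∈ E₂(R) and every solution V of the λ = 1 lattice that is normalised
(‖V_n‖ ≤ 1), non-evanescent, square-summable, completely draining (below every shell as s → +∞,
above every shell as s → −∞) and action-bounded (∫‖V_n‖ ds ≤ M), a windowed A-increment budget
∫_{s₁}^{s₂} Σ_{i<w} ‖A V_{a+i} − A V_{a+i+1}‖² ≤ C₁√w + C₂ (uniform in a, s₁ ≤ s₂) forces V ≡ 0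
(indeed is contradictory). Proof = steps 2–5 verbatim with `hupper := window_integral …` replaced by
the hypothesis at (a, w + r) = (0, w + r): complete drain gives a late and an early time between
which every bond of the window passes flux ≥ 3E/8 (`tailAbove_sub`, `energy_conserved`);
`shell_floor` with η = E²/(128(C_A M² + 1)) turns flux into ∫(‖A V_i‖ − η)₊² ≥ ηE/4 per shell
(seepage below η costs action); `coercive_window_pointwise` with r = ⌈C_A E/η⌉ + 1 bounds that by
r²·Σ_{i<w+r}‖A V_i − A V_{i+1}‖² pointwise; `false_of_linear_le_sqrt` (C₁, C₂ replaced by their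
positive parts) finishes: linear cost w·ηE/ -/
@[route_item "route-NavierStokesRegularity-TransitMassLedger", crux]
def IncrementBoundRigidity : Prop :=
  ∀ R : ℝ, 1 ≤ R → ∀ α : Fin 4 → Fin 4 → Fin 4 → ℤ × ℤ × ℤ → ℝ, Literature.Analysis.FluidPDE.TaoCascade.InTableClass R α → ∀ V : ℤ → ℝ → EuclideanSpace ℝ (Fin 4), (∀ (n : ℤ) (s : ℝ), HasDerivAt (V n) (Literature.Analysis.FluidPDE.TaoCascade.tableQ α (V n s) + Literature.Analysis.FluidPDE.TaoCascade.tableA α (V (n - 1) s) + Literature.Analysis.FluidPDE.TaoCascade.tableB α (V (n + 1) s) (V n s)) s) → (∀ (n : ℤ) (s : ℝ), ‖V n s‖ ≤ 1) → (∃ c : ℝ, 0 < c ∧ ∀ s : ℝ, ∃ n : ℤ, c ≤ ‖V n s‖) → (∀ s : ℝ, Summable (fun n : ℤ => ‖V n s‖ ^ 2)) → (∀ N : ℤ, Filter.Tendsto (fun s : ℝ => ∑' k : ℕ, ‖V (N - (k : ℤ)) s‖ ^ 2) Filter.atTop (nhds 0)) → (∀ N : ℤ, Filter.Tendsto (fun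 s : ℝ => ∑' k : ℕ, ‖V (N + (k : ℤ)) s‖ ^ 2) Filter.atBot (nhds 0)) → (∃ M : ℝ, ∀ n : ℤ, MeasureTheory.Integrable (fun s : ℝ => ‖V n s‖) ∧ ∫ s, ‖V n s‖ ≤ M) → (∃ C₁ C₂ : ℝ, ∀ (a : ℤ) (w : ℕ) (s₁ s₂ : ℝ), s₁ ≤ s₂ → ∫ s in s₁..s₂, ∑ i ∈ Finset.range w, ‖Literature.Analysis.FluidPDE.TaoCascade.tableA α (V (a + i) s) - Literature.Analysis.FluidPDE.TaoCascade.tableA α (V (a + i + 1) s)‖ ^ 2 ≤ C₁ * Real.sqrt w + C₂) → ∀ (n : ℤ) (s : ℝ), V n s = 0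

-- `IncrementBoundRigidity` holds: proved by `Summit.NavierStokesRegularity.NavierStokesRegularity.Theorems.TransitMassLedgerEmptyTransitClass.incrementBoundRigidity_trivial` (its module imports this route file, so no `_holds` link can be stated here).

/-- item stmt-NavierStokesRegularity-27969 · support · rank 9 · closed · proved by Summit.NavierStokesRegularity.NavierStokesRegularity.Theorems.TransitMassLedgerCertifiedIncrementBound.transitMassLedger_certifiedIncrementBound_proof (prover) · by planner
why it might fail: none — provable now: telescoping + Cauchy–Schwarz + energy_conserved exactly as window_integral (degree-1 case landed); formal cost M (interval-integral bookkeeping for a C¹ two-state density).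
sources: doi:10.1007/bf00276493, arXiv:1402.0290, doi:10.1109/cdc.2011.6161499
[support, provable now, size M] MULTI-STATE LEDGER ⇒ BUDGET (step 1 of the LedgerRigidity proof,
`TransitMassLedgerLedgerRigidityWindows.window_integral`, widened from the degree-1 mass ledger
Σ⟪ℓ,V_n⟫ to any Lyapunov ledger Σ_n Λ(V_n, V_{n+1})): if α admits a certificate of any degree — a
two-state density Λ : ℝ⁴ × ℝ⁴ → ℝ, C¹ along C¹ curves (the chain rule is PACKAGED as the hypothesis
on Λ₁, Λ₂: HasDerivAt of σ ↦ Λ(γ σ, δ σ) with derivative Λ₁(γ,δ)γ′ + Λ₂(γ,δ)δ′), of linear growth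
|Λ(x,y)| ≤ C(‖x‖ + ‖y‖) on the ball, a three-state flux correction g with |g(x,y,z)| ≤
C(‖x‖+‖y‖+‖z‖), κ > 0, and the production inequality κ‖A x − A y‖² + g(a,x,y) − g(x,y,b) ≤ Λ₁(x,y)[Q
x + A a + B(y,x)] + Λ₂(x,y)[Q y + A x + B(b,y)] for all 4-tuples (a,x,y,b) of the unit ball (a =
lower neighbour, b = upper neighbour) — then every normalised, square-summable, action-bounded
solution obeys the windowed A-increment budget: d/ds Σ_{i<w} Λ(V_{a+i}, V_{a+i+1}) ≥ Σ_{i<w}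
production, the g-terms telescope to two boundary fluxes with time-integral ≤ 3CM each, and |Σ_{i<w}
Λ| ≤ 2C Σ_{i≤w} ‖V_{a+i}‖ ≤ 2C√((w+1)E) by Cauchy–Schwarz with E the conserved energy
(`TransitMassLedgerEnergy.energy_conserved`); hence -/
@[route_item "route-NavierStokesRegularity-TransitMassLedger", crux]
def CertifiedIncrementBound : Prop :=
  ∀ R : ℝ, 1 ≤ R → ∀ α : Fin 4 → Fin 4 → Fin 4 → ℤ × ℤ × ℤ → ℝ, Literature.Analysis.FluidPDE.TaoCascade.InTableClass R α → (∃ (Λ : EuclideanSpace ℝ (Fin 4) → EuclideanSpace ℝ (Fin 4) → ℝ) (Λ₁ Λ₂ : EuclideanSpace ℝ (Fin 4) → EuclideanSpace ℝ (Fin 4) → EuclideanSpace ℝ (Fin 4) → ℝ) (g : EuclideanSpace ℝ (Fin 4) → EuclideanSpace ℝ (Fin 4) → EuclideanSpace ℝ (Fin 4) → ℝ) (κ C : ℝ), 0 < κ ∧ (∀ (γ δ : ℝ → EuclideanSpace ℝ (Fin 4)) (γ' δ' : EuclideanSpace ℝ (Fin 4)) (s : ℝ), HasDerivAt γ γ'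 s → HasDerivAt δ δ' s → HasDerivAt (fun σ => Λ (γ σ) (δ σ)) (Λ₁ (γ s) (δ s) γ' + Λ₂ (γ s) (δ s) δ') s) ∧ (∀ x y : EuclideanSpace ℝ (Fin 4), ‖x‖ ≤ 1 → ‖y‖ ≤ 1 → |Λ x y| ≤ C * (‖x‖ + ‖y‖)) ∧ (∀ x y z : EuclideanSpace ℝ (Fin 4), ‖x‖ ≤ 1 → ‖y‖ ≤ 1 → ‖z‖ ≤ 1 → |g x y z| ≤ C * (‖x‖ + ‖y‖ + ‖z‖)) ∧ ∀ a x y b : EuclideanSpace ℝ (Fin 4), ‖a‖ ≤ 1 → ‖x‖ ≤ 1 → ‖y‖ ≤ 1 → ‖b‖ ≤ 1 → κ * ‖Literature.Analysis.FluidPDE.TaoCascade.tableA α x - Literature.Analysis.FluidPDE.TaoCascade.tableA α y‖ ^ 2 + g a x y - g x y b ≤ Λ₁ x y (Literature.Analysis.FluidPDE.TaoCascade.tableQ α x + Literature.Analysis.FluidPDE.TaoCascade.tableA α a + Literature.Analysis.FluidPDE.TaoCascade.tableB α y x) + Λ₂ x y (Literature.Analysis.FluidPDE.TaoCascade.tableQ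 α y + Literature.Analysis.FluidPDE.TaoCascade.tableA α x + Literature.Analysis.FluidPDE.TaoCascade.tableB α b y)) → ∀ V : ℤ → ℝ → EuclideanSpace ℝ (Fin 4), (∀ (n : ℤ) (s : ℝ), HasDerivAt (V n) (Literature.Analysis.FluidPDE.TaoCascade.tableQ α (V n s) + Literature.Analysis.FluidPDE.TaoCascade.tableA α (V (n - 1) s) + Literature.Analysis.FluidPDE.TaoCascade.tableB α (V (n + 1) s) (V n s)) s) → (∀ (n : ℤ) (s : ℝ), ‖V n s‖ ≤ 1) → (∀ s : ℝ, Summable (fun n : ℤ => ‖V n s‖ ^ 2)) → (∃ M : ℝ, ∀ n : ℤ, MeasureTheory.Integrable (fun s : ℝ => ‖V n s‖) ∧ ∫ s, ‖V n s‖ ≤ M) → (∃ C₁ C₂ : ℝ, ∀ (a : ℤ) (w : ℕ) (s₁ s₂ : ℝ), s₁ ≤ s₂ → ∫ s in s₁..s₂, ∑ i ∈ Finset.range w, ‖Literature.Analysis.FluidPDE.TaoCascade.tableA α (V (a + i) s) - Literature.Analysis.FluidPDE.TaoCascade.tableA α (V (a + i + 1) s)‖ ^ 2 ≤ C₁ *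 Real.sqrt w + C₂)

-- `CertifiedIncrementBound` holds: proved by `Summit.NavierStokesRegularity.NavierStokesRegularity.Theorems.TransitMassLedgerCertifiedIncrementBound.transitMassLedger_certifiedIncrementBound_proof` (its module imports this route file, so no `_holds` link can be stated here).

/-- item stmt-NavierStokesRegularity-24401 · assembly · rank 1 · closed · proved by Summit.NavierStokesRegularity.NavierStokesRegularity.Theorems.transitMassLedger_assembly_proof (prover) · by planner
sources: arXiv:1402.0290, Literature.Analysis.FluidPDE.Tao2016AveragedNS.BoundedEternalSolutions
[assembly] ActionTransitExtraction → LedgerRigidity → BackscatterRigidity → NoLoudLadderOne →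
EternalRigidityViscBddOne → rung target TaoLadderRungTwoBreak.Target. -/
@[route_item "route-NavierStokesRegularity-TransitMassLedger"]
def Assembly : Prop :=
  ActionTransitExtraction → LedgerRigidity → BackscatterRigidity → NoLoudLadderOne → EternalRigidityViscBddOne → Summit.NavierStokesRegularity.NavierStokesRegularity.Theses.TaoLadderRungTwoBreak.Target

-- `Assembly` holds: proved by `Summit.NavierStokesRegularity.NavierStokesRegularity.Theorems.transitMassLedger_assembly_proof` (its module imports this route file, so no `_holds` link can be stated here).

/-! D-0027 §2.1 — DECIDING THEOREM (planner-authored via `route open/edit --closes-file`; by planner-ns-idea-1-g6-0 2026-08-28T13:36:53Z):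
its hypotheses are this route's items and its conclusion the registered leaf `Summit.NavierStokesRegularity.NavierStokesRegularity.Theses.TaoLadderRungTwoBreak.Target` (rung TL-M2Break, D-0061) (glue_lint), and it elaborates with this file. -/

@[closes "route-NavierStokesRegularity-TransitMassLedger"] theorem closes (h1 : ActionTransitExtraction) (h2 : LedgerRigidity) (h3 : IncrementBoundRigidity)
    (h4 : CertifiedIncrementBound) (h5 : ResidualIncrementBound) (h6 : NoLoudLadderOne)
    (h7 : EternalRigidityViscBddOne) :
    Summit.NavierStokesRegularity.NavierStokesRegularity.Theses.TaoLadderRungTwoBreak.Target := by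
  intro R hR
  have h0 : Literature.Analysis.FluidPDE.TaoCascade.NoSurvivingEternalBdd R 1 := by
    by_contra h
    obtain ⟨α, hα, V, hl, hb, hc, hs, hf, hbk, hact, n, s, hne⟩ := h1 R hR h
    -- regime 1 (PROVED, item 24398): a degree-1 outflow-coercive mass certificate
    by_cases hdeg : ∃ (ℓ : EuclideanSpace ℝ (Fin 4)) (θ : EuclideanSpace ℝ (Fin 4) → ℝ) (κ : ℝ), 0 < κ ∧ Continuous θ ∧ θ 0 = 0 ∧ ∀ x y : EuclideanSpace ℝ (Fin 4), ‖x‖ ≤ 1 → ‖y‖ ≤ 1 → κ * ‖Literature.Analysis.FluidPDE.TaoCascade.tableA α x - Literature.Analysis.FluidPDE.TaoCascade.tableA α y‖ ^ 2 ≤ inner ℝ ℓ (Literature.Analysis.FluidPDE.TaoCascade.tableQ α x + Literature.Analysis.FluidPDE.TaoCascade.tableA α x + Literature.Analysis.FluidPDE.TaoCascade.tableB α y x) + θ x - θ y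
    · obtain ⟨ℓ, θ, κ, hκ, hθc, hθ0, hM⟩ := hdeg
      exact hne (h2 R hR α hα ℓ θ κ hκ hθc hθ0 hM V hl hb hc hs hf hbk hact n s)
    -- regime 2 (provable supports): a multi-state Lyapunov-ledger certificate gives the increment budget
    by_cases hcert : (∃ (Λ : EuclideanSpace ℝ (Fin 4) → EuclideanSpace ℝ (Fin 4) → ℝ) (Λ₁ Λ₂ : EuclideanSpace ℝ (Fin 4) → EuclideanSpace ℝ (Fin 4) → EuclideanSpace ℝ (Fin 4) → ℝ) (g : EuclideanSpace ℝ (Fin 4) → EuclideanSpace ℝ (Fin 4) → EuclideanSpace ℝ (Fin 4) → ℝ) (κ C : ℝ), 0 < κ ∧ (∀ (γ δ : ℝ → EuclideanSpace ℝ (Fin 4)) (γ' δ' : EuclideanSpace ℝ (Fin 4)) (s : ℝ), HasDerivAt γ γ' s → HasDerivAt δ δ' s → HasDerivAt (fun σ => Λ (γ σ) (δ σ)) (Λ₁ (γ s) (δ s) γ' + Λ₂ (γ s) (δ s) δ') s) ∧ (∀ x y : EuclideanSpace ℝ (Fin 4), ‖x‖ ≤ 1 → ‖y‖ ≤ 1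 → |Λ x y| ≤ C * (‖x‖ + ‖y‖)) ∧ (∀ x y z : EuclideanSpace ℝ (Fin 4), ‖x‖ ≤ 1 → ‖y‖ ≤ 1 → ‖z‖ ≤ 1 → |g x y z| ≤ C * (‖x‖ + ‖y‖ + ‖z‖)) ∧ ∀ a x y b : EuclideanSpace ℝ (Fin 4), ‖a‖ ≤ 1 → ‖x‖ ≤ 1 → ‖y‖ ≤ 1 → ‖b‖ ≤ 1 → κ * ‖Literature.Analysis.FluidPDE.TaoCascade.tableA α x - Literature.Analysis.FluidPDE.TaoCascade.tableA α y‖ ^ 2 + g a x y - g x y b ≤ Λ₁ x y (Literature.Analysis.FluidPDE.TaoCascade.tableQ α x + Literature.Analysis.FluidPDE.TaoCascade.tableA α a + Literature.Analysis.FluidPDE.TaoCascade.tableB α y x) + Λ₂ x y (Literature.Analysis.FluidPDE.TaoCascade.tableQ α y + Literature.Analysis.FluidPDE.TaoCascade.tableA α x + Literature.Analysis.FluidPDE.TaoCascade.tableB α b y))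
    · exact hne (h3 R hR α hα V hl hb hc hs hf hbk hact (h4 R hR α hα hcert V hl hb hs hact) n s)
    -- regime 3 (the open residual crux): no ledger of any degree
    · exact hne (h3 R hR α hα V hl hb hc hs hf hbk hact (h5 R hR α hα hcert V hl hb hc hs hf hbk hact) n s)
  exact Literature.Analysis.FluidPDE.TaoCascade.noRobustBlowupBelow_of_eternalViscBdd
    (Literature.Analysis.FluidPDE.TaoCascade.noSurvivingEternalViscBddOne_of h0 (h6 R hR)) (h7 R hR)

end Summit.NavierStokesRegularity.NavierStokesRegularity.Theses.TransitMassLedger
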